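import Literature.Computability.AlgebraicComplexity.AsymptoticSumInequalityAsymptoticRank
import Literature.Computability.AlgebraicComplexity.SchonhageRectangular
import Literature.Computability.AlgebraicComplexity.MonomialRestrictionProducts
import Literature.Computability.AlgebraicComplexity.RelativeExponentTriangle
import Literature.Barriers.MatrixMultiplication.UniversalMethodBarrierDegenerationPow
import Literature.Barriers.MatrixMultiplication.UniversalMethodBarrierAsymptoticRank
import HarnessLib

/-!
# The value of a tensor (Coppersmith–Winograd 1990; Le Gall 2014, Def. 2.1 and Thm. 2.2) — definitions and proved closure properties

Topic `Literature/Computability/AlgebraicComplexity`.  The laser method beyond matrix components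
(Coppersmith–Winograd 1990 §8: `ω < 2.376`; Stothers; Vassilevska Williams; Le Gall 2014) runs on
the **value** of a tensor.  Le Gall 2014 (arXiv:1401.7714), §2.2:

> Given a tensor `t` and `N`, consider the pairs `(e, m)` such that `(t ⊗ t_C ⊗ t_{C²})^{⊗N}` can be
> degenerated into a direct sum of `e` tensors isomorphic to `⟨m,m,m⟩`; `V_{ρ,N}(t) = max (e m^ρ)^{1/(3N)}`.
> **Definition 2.1.** `V_ρ(t) = lim_{N→∞} V_{ρ,N}(t)`.  … `V_ρ(⟨m,n,p⟩) ≥ (mnp)^{ρ/3}`; the value is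
> superadditive and supermultiplicative.  **Theorem 2.2.** If `V_ρ(t) ≥ R̲(t)` then `ω ≤ ρ`.

This file vendors the notion in the form in which it is USED by the laser method — as a lower-bound
predicate with explicit degeneration witnesses — and proves its closure properties:

* `HasLaserValue ρ t v` — "`V_ρ(t) ≥ v`": for every `ε > 0` some power `t^{⊗N}` (`N ≥ 1`)
  degenerates (`PolyDegeneratesTo`, Alman's `λ`-degeneration = BCS's `⊴`) into a direct sum of
  matrix tensors `⊕ᵢ ⟨kᵢ, mᵢ, nᵢ⟩` (`matMulDirectSum`) with `v^N ≤ (1+ε)^N ∑ᵢ (kᵢ mᵢ nᵢ)^{ρ/3}`.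
  Direct sums of matrix tensors of arbitrary formats are allowed, as in Coppersmith–Winograd's and
  Stothers–Vassilevska Williams's `V_τ` ("if `⊕ᵢ ⟨kᵢ,mᵢ,nᵢ⟩ ⊴ t^{⊗N}` then the value of `t` is at
  least `(∑ (kᵢmᵢnᵢ)^τ)^{1/N}`", Bläser 2013 §9.4); Le Gall's cube-only variant with the
  symmetrisation `t ⊗ t_C ⊗ t_{C²}` gives the same lower bounds in all applications (it is only ever
  bounded from below through these properties).
* `hasLaserValue_of_witness` — one witness at one power gives `V_ρ(t) ≥ (∑ (kᵢmᵢnᵢ)^{ρ/3})^{1/N}`;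
  `hasLaserValue_of_lt_degenerationValue` — the bridge from the tree's number `degenerationValue`;
  `hasLaserValue_matMulTensor` — **`V_ρ(⟨k,m,n⟩) ≥ (kmn)^{ρ/3}`**;
  `HasLaserValue.mono`, `HasLaserValue.of_polyDegeneratesTo` — monotone in `v` and under `⊴`
  ("`V_ρ(t) ≥ V_ρ(t')` for `t' ⊴ t`");
  `HasLaserValue.multiple` — **`V_ρ(e ⊙ t) ≥ e · V_ρ(t)`** (superadditivity for copies, the case
  used by the laser method, where all blocks of the free diagonal have the same type);
* `omega_le_of_hasLaserValue` — **Thm. 2.2 in its correct effective form**: if `V_ρ(t) ≥ v` and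
  `v > R̃(t)` (asymptotic rank; `R̃ ≤ R̲`) then `ω ≤ ρ`.  (As printed — with `≥ R̲(t)` — Thm. 2.2
  fails for trivial tensors: `t = ⟨1⟩` has `V_ρ(t) = R̲(t) = 1` for every `ρ`, which would give
  `ω ≤ 2`; the strict form is what the applications use: one solves `Ṽ_ρ(CW_q) = q + 2` for `ρ` and
  every `ρ' > ρ` has `Ṽ_{ρ'} > q + 2 ≥ R̃(CW_q)`.)  Proof: `∑ (kᵢmᵢnᵢ)^{ω/3} ≤ R̃(⊕ᵢ⟨kᵢ,mᵢ,nᵢ⟩)`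
  (`sum_rpow_omega_le_asymptoticRank`) `≤ R̃(t^{⊗N}) ≤ R̃(t)^N`, and `ρ ≤ ω` would give
  `v^N ≤ (1+ε)^N R̃(t)^N` for all `ε`.

## Relation to the tree's `degenerationValue` (library fit)

The tree already holds the value as a NUMBER: `Literature.Barriers.MatrixMultiplication.degenerationValue K τ t`
(`UniversalMethodBarrier.lean`, Alman 2021 §2.5 = Coppersmith–Winograd's `V_τ`, `τ = ρ/3`: the real
`sSup` over `n > 0` and all degenerations `t^{⊗n} ⊵ ⊕ᵢ ⟨aᵢ,bᵢ,cᵢ⟩` with `aᵢ,bᵢ,cᵢ ≥ 1` of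
`(∑ (aᵢbᵢcᵢ)^τ)^{1/n}`; searched: `degenerationValue`, `universalOmega`, `value`).  `HasLaserValue ρ t v`
is "`v ≤ V_{ρ/3}(t)`" in PREDICATE form: the laser method produces and consumes explicit witnesses
(they are powered, multiplied and summed), while the tree's `sSup` has no proved `BddAbove`, so a
bound `V_τ(t) ≥ v` read off the number cannot be pushed back into witnesses — the predicate carries
them.  The bridge in the usable direction is `hasLaserValue_of_lt_degenerationValue`
(`0 ≤ v < V_{ρ/3}(t) ⇒ HasLaserValue ρ t v`, from `exists_lt_of_lt_csSup`), so that results stated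
through `degenerationValue` (the catalogued Universal-Method barrier `universalOmega`) meet results of
this route; the converse (`HasLaserValue ρ t v ⇒ v ≤ V_{ρ/3}(t)` under a `BddAbove` hypothesis,
discarding the blocks with `aᵢbᵢcᵢ = 0`, which contribute `0` for `ρ > 0`) is deferred to the file that
proves `BddAbove` for the value set.  At `ρ = 0` the predicate is trivially true for all `t` and `v`: blocks `⟨0,0,0⟩` contribute `(0:ℝ)^(0:ℝ) = 1` each and `t^{⊗N}` degenerates to any
number of them; this is why `omega_le_of_hasLaserValue` assumes `0 < ρ`.

Supermultiplicativity (`V_ρ(t ⊗ t') ≥ V_ρ(t) V_ρ(t')`, in the `N`-fold form needed for the blocks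
`⊗_ρ t(x_ρ,y_ρ,z_ρ)` of a power) is the subject of the companion file `LaserValueProducts.lean`.
One definition (`HasLaserValue`); everything else proved; no named facts.

## References

* F. Le Gall, *Powers of tensors and fast matrix multiplication*, ISSAC 2014, arXiv:1401.7714
  (held: `paper:arxiv-1401.7714`, p. 4): §2.2, Def. 2.1, Thm. 2.2. [LeGall2014]
* D. Coppersmith, S. Winograd, *Matrix multiplication via arithmetic progressions*, J. Symbolic
  Comput. 9 (1990) 251–280, §8 (the value `V_τ`). [CoppersmithWinograd1990]
* M. Bläser, *Fast Matrix Multiplication*, ToC Graduate Surveys 5 (2013), §9.4 (p. 50: "the value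
  of `t` is at least `(∑ (kᵢmᵢnᵢ)^τ)^{1/N}`"). [Blaser2013]
* J. Alman, *Limits on the Universal Method for matrix multiplication*, Theory of Computing 17
  (2021), §2.5 (`V_τ`, as vendored in `UniversalMethodBarrier.lean`). [Alman2021]
-/

noncomputable section

open scoped BigOperators
open Finset Filter Topology

namespace Literature.Computability.AlgebraicComplexity

open Literature.Barriers.MatrixMultiplication (PolyDegeneratesTo PolyDegeneratesTo.trans
  PolyDegeneratesTo.kronecker PolyDegeneratesTo.kroneckerPow asymptoticRank_le_of_polyDegeneratesTo
  asymptoticRank_kroneckerPow_le)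

universe u

/-! ## The definition -/

section Defs

variable {K : Type u} [Field K]
variable {ι κ μ : Type*} [Fintype ι] [Fintype κ] [Fintype μ]

/-- **`V_ρ(t) ≥ v`** — the value of the tensor `t` at the parameter `ρ` is at least `v`
(Coppersmith–Winograd's `V_τ`, `τ = ρ/3`, in the normalisation of Bläser 2013 §9.4 / Alman 2021
§2.5 — arbitrary formats, no symmetrisation, `N`-th roots — of which Le Gall 2014, Def. 2.1 is the
cube-only symmetrised variant): for every `ε > 0` some power `t^{⊗N}`, `N ≥ 1`, degenerates into a
direct sum of matrix tensors `⊕ᵢ ⟨kᵢ, mᵢ, nᵢ⟩` with `v^N ≤ (1 + ε)^N · ∑ᵢ (kᵢ mᵢ nᵢ)^{ρ/3}`.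
Predicate form of "`v ≤ degenerationValue K (ρ/3) t`" (see the module docstring and
`hasLaserValue_of_lt_degenerationValue`).  Degenerate blocks `kᵢmᵢnᵢ = 0` are allowed (they contribute
`0` for `ρ > 0`; at `ρ = 0` the predicate is trivially true).
[cite: Blaser2013, §9.4] [cite: LeGall2014, Def. 2.1] -/
def HasLaserValue (ρ : ℝ) (t : ι → κ → μ → K) (v : ℝ) : Prop :=
  ∀ ε : ℝ, 0 < ε → ∃ N : ℕ, 1 ≤ N ∧ ∃ (p : ℕ) (k m n : Fin p → ℕ),
    PolyDegeneratesTo (kroneckerPow t N) (matMulDirectSum K k m n) ∧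
      v ^ N ≤ (1 + ε) ^ N * ∑ i, ((k i * m i * n i : ℕ) : ℝ) ^ (ρ / 3)

end Defs

/-! ## Witnesses, monotonicity -/

section Basic

variable {K : Type u} [Field K]
variable {ι κ μ ι' κ' μ' : Type*} [Fintype ι] [Fintype κ] [Fintype μ] [Fintype ι'] [Fintype κ']
  [Fintype μ'] [DecidableEq ι] [DecidableEq κ] [DecidableEq μ] [DecidableEq ι'] [DecidableEq κ']
  [DecidableEq μ']

omit [DecidableEq ι] [DecidableEq κ] [DecidableEq μ] in
/-- **One witness gives a value bound** ("if `⊕ᵢ ⟨kᵢ,mᵢ,nᵢ⟩ ⊴ t^{⊗N}` then the value of `t` is at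
least `(∑ (kᵢmᵢnᵢ)^τ)^{1/N}`", Bläser 2013 §9.4). [cite: Blaser2013, §9.4] -/
theorem hasLaserValue_of_witness {ρ : ℝ} {t : ι → κ → μ → K} {N : ℕ} (hN : 1 ≤ N) {p : ℕ}
    {k m n : Fin p → ℕ} (h : PolyDegeneratesTo (kroneckerPow t N) (matMulDirectSum K k m n)) :
    HasLaserValue ρ t ((∑ i, ((k i * m i * n i : ℕ) : ℝ) ^ (ρ / 3)) ^ ((N : ℝ)⁻¹)) := by
  intro ε hε
  refine ⟨N, hN, p, k, m, n, h, ?_⟩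
  have hS : 0 ≤ ∑ i, ((k i * m i * n i : ℕ) : ℝ) ^ (ρ / 3) :=
    Finset.sum_nonneg fun i _ => Real.rpow_nonneg (Nat.cast_nonneg _) _
  have hN0 : (N : ℝ) ≠ 0 := by exact_mod_cast (by omega : N ≠ 0)
  rw [← Real.rpow_natCast, ← Real.rpow_mul hS, inv_mul_cancel₀ hN0, Real.rpow_one]
  have h1 : (1 : ℝ) ≤ (1 + ε) ^ N := one_le_pow₀ (by linarith)
  nlinarith

omit [DecidableEq ι] [DecidableEq κ] [DecidableEq μ] in
/-- Monotonicity in the bound: `V_ρ(t) ≥ v ≥ v' ≥ 0 ⇒ V_ρ(t) ≥ v'`. [folklore] -/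
theorem HasLaserValue.mono {ρ : ℝ} {t : ι → κ → μ → K} {v v' : ℝ} (h : HasLaserValue ρ t v)
    (hv' : 0 ≤ v') (hvv' : v' ≤ v) : HasLaserValue ρ t v' := by
  intro ε hε
  obtain ⟨N, hN, p, k, m, n, hdeg, hb⟩ := h ε hε
  exact ⟨N, hN, p, k, m, n, hdeg, (pow_le_pow_left₀ hv' hvv' N).trans hb⟩

/-- **The value is monotone under degeneration**: `t ⊵ t'`, `V_ρ(t') ≥ v ⇒ V_ρ(t) ≥ v`
(Le Gall: "`V_ρ(t) ≥ V_ρ(t')` for any tensors `t, t'` such that `t' ⊴ t`").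
[cite: LeGall2014, §2.2] -/
theorem HasLaserValue.of_polyDegeneratesTo {ρ : ℝ} {t : ι → κ → μ → K} {t' : ι' → κ' → μ' → K}
    {v : ℝ} (htt' : PolyDegeneratesTo t t') (h : HasLaserValue ρ t' v) : HasLaserValue ρ t v := by
  intro ε hε
  obtain ⟨N, hN, p, k, m, n, hdeg, hb⟩ := h ε hε
  exact ⟨N, hN, p, k, m, n, (PolyDegeneratesTo.kroneckerPow htt' N).trans hdeg, hb⟩

/-- In particular the value is monotone under restriction. [cite: LeGall2014, §2.2] -/
theorem HasLaserValue.of_restrictsTo {ρ : ℝ} {t : ι → κ → μ → K} {t' : ι' → κ' → μ' → K}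
    {v : ℝ} (htt' : TensorRestrictsTo t t') (h : HasLaserValue ρ t' v) : HasLaserValue ρ t v :=
  h.of_polyDegeneratesTo htt'.polyDegeneratesTo

omit [DecidableEq ι] [DecidableEq κ] [DecidableEq μ] in
/-- **Bridge to the tree's `degenerationValue`**: `0 ≤ v < V_{ρ/3}(t) ⇒ HasLaserValue ρ t v`
(an element of the value set exceeding `v` is a witness; the set is non-empty — it contains `0`, the
empty direct sum — so `exists_lt_of_lt_csSup` applies without any boundedness).
[cite: Alman2021, §2.5] -/
theorem hasLaserValue_of_lt_degenerationValue {ρ : ℝ} {t : ι → κ → μ → K} {v : ℝ} (hv : 0 ≤ v)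
    (h : v < Literature.Barriers.MatrixMultiplication.degenerationValue K (ρ / 3) t) :
    HasLaserValue ρ t v := by
  unfold Literature.Barriers.MatrixMultiplication.degenerationValue at h
  have hne : ({v : ℝ | ∃ n : ℕ, 0 < n ∧ ∃ (m : ℕ) (a b c : Fin m → ℕ),
      (∀ i, 0 < a i ∧ 0 < b i ∧ 0 < c i) ∧
        PolyDegeneratesTo (kroneckerPow t n) (matMulDirectSum K a b c) ∧
          v = (∑ i, ((a i * b i * c i : ℕ) : ℝ) ^ (ρ / 3)) ^ (1 / (n : ℝ))}).Nonempty := by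
    refine ⟨0, 1, Nat.one_pos, 0, Fin.elim0, Fin.elim0, Fin.elim0, fun i => Fin.elim0 i, ?_, by simp⟩
    exact ⟨0, fun _ x => Fin.elim0 x.1, fun _ x => Fin.elim0 x.1, fun _ x => Fin.elim0 x.1,
      fun x => Fin.elim0 x.1⟩
  obtain ⟨x, ⟨n, hn, m, a, b, c, -, hdeg, rfl⟩, hvx⟩ := exists_lt_of_lt_csSup hne h
  have hw := hasLaserValue_of_witness (ρ := ρ) (Nat.one_le_iff_ne_zero.2 hn.ne') hdeg
  rw [one_div] at hvx
  exact hw.mono hv hvx.le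

end Basic

/-! ## Matrix tensors -/

section MatMul

variable (K : Type u) [Field K]

/-- `⟨k,m,n⟩` restricts to the one-block direct sum `⊕_{i<1} ⟨k,m,n⟩` (general formats; the cubic case is
`tensorRestrictsTo_matMulTensor_matMulDirectSum_one` of `AsymptoticRankMatMul.lean`). [folklore] -/
theorem tensorRestrictsTo_matMulTensor_matMulDirectSum_single (k m n : ℕ) :
    TensorRestrictsTo (matMulTensor K k m n)
      (matMulDirectSum K (fun _ : Fin 1 => k) (fun _ => m) (fun _ => n)) := by
  classical
  have h := tensorRestrictsTo_precomp (matMulTensor K k m n)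
    (fun a : Σ _ : Fin 1, Fin k × Fin n => a.2) (fun b : Σ _ : Fin 1, Fin k × Fin m => b.2)
    (fun c : Σ _ : Fin 1, Fin m × Fin n => c.2)
  convert h using 1
  funext a b c
  have ha : a.1 = b.1 := Subsingleton.elim _ _
  have hb : b.1 = c.1 := Subsingleton.elim _ _
  simp [matMulDirectSum, matMulTensor, ha, hb, Fin.ext_iff]

/-- **`V_ρ(⟨k,m,n⟩) ≥ (kmn)^{ρ/3}`** ("By definition, `V_ρ(⟨m,n,p⟩) ≥ (mnp)^{ρ/3}`").
[cite: LeGall2014, §2.2] -/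
theorem hasLaserValue_matMulTensor (ρ : ℝ) (k m n : ℕ) :
    HasLaserValue ρ (matMulTensor K k m n) (((k * m * n : ℕ) : ℝ) ^ (ρ / 3)) := by
  classical
  have hdeg : PolyDegeneratesTo (kroneckerPow (matMulTensor K k m n) 1)
      (matMulDirectSum K (fun _ : Fin 1 => k) (fun _ => m) (fun _ => n)) :=
    ((tensorRestrictsTo_kroneckerPow_one (matMulTensor K k m n)).trans
      (tensorRestrictsTo_matMulTensor_matMulDirectSum_single K k m n)).polyDegeneratesTo
  have h := hasLaserValue_of_witness (ρ := ρ) (le_refl 1) hdeg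
  simpa using h

end MatMul

/-! ## Multiples: `V_ρ(e ⊙ t) ≥ e · V_ρ(t)` -/

section Multiple

variable (K : Type u) [Field K]

/-- `⟨e⟩ ⊗ (⊕ᵢ ⟨kᵢ,mᵢ,nᵢ⟩)` restricts to the direct sum with `e · p` blocks `⟨k_i, m_i, n_i⟩`,
block `(j, i) ↦` the `j`-th copy of block `i`. [folklore] -/
theorem tensorRestrictsTo_unit_kronecker_matMulDirectSum (e : ℕ) {p : ℕ} (k m n : Fin p → ℕ) :
    TensorRestrictsTo (kroneckerTensor (unitTensor K e) (matMulDirectSum K k m n))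
      (matMulDirectSum K (fun j : Fin (e * p) => k (finProdFinEquiv.symm j).2)
        (fun j => m (finProdFinEquiv.symm j).2) (fun j => n (finProdFinEquiv.symm j).2)) := by
  classical
  have h := tensorRestrictsTo_precomp (kroneckerTensor (unitTensor K e) (matMulDirectSum K k m n))
    (fun a : Σ j : Fin (e * p), Fin (k (finProdFinEquiv.symm j).2) × Fin (n (finProdFinEquiv.symm j).2) =>
      ((finProdFinEquiv.symm a.1).1, (⟨(finProdFinEquiv.symm a.1).2, a.2⟩ : Σ i, Fin (k i) × Fin (n i))))
    (fun b : Σ j : Fin (e * p), Fin (k (finProdFinEquiv.symm j).2) × Fin (m (finProdFinEquiv.symm j).2) =>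
      ((finProdFinEquiv.symm b.1).1, (⟨(finProdFinEquiv.symm b.1).2, b.2⟩ : Σ i, Fin (k i) × Fin (m i))))
    (fun c : Σ j : Fin (e * p), Fin (m (finProdFinEquiv.symm j).2) × Fin (n (finProdFinEquiv.symm j).2) =>
      ((finProdFinEquiv.symm c.1).1, (⟨(finProdFinEquiv.symm c.1).2, c.2⟩ : Σ i, Fin (m i) × Fin (n i))))
  convert h using 1
  funext a b c
  have key : ∀ x y : Fin (e * p), x = y ↔ (finProdFinEquiv.symm x).1 = (finProdFinEquiv.symm y).1 ∧
      (finProdFinEquiv.symm x).2 = (finProdFinEquiv.symm y).2 := fun x y => by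
    rw [← Prod.ext_iff, Equiv.apply_eq_iff_eq]
  rw [kroneckerTensor_apply, unitTensor_apply]
  unfold matMulDirectSum
  dsimp only
  have k1 := key a.1 b.1
  have k2 := key b.1 c.1
  by_cases H1 : a.1 = b.1 ∧ b.1 = c.1 ∧ (a.2.1 : ℕ) = b.2.1 ∧ (b.2.2 : ℕ) = c.2.1 ∧ (a.2.2 : ℕ) = c.2.2
  · -- a diagonal entry: both block conditions on the right hold
    obtain ⟨h12, h23, hd⟩ := H1
    rw [if_pos ⟨h12, h23, hd⟩, if_pos ⟨(k1.1 h12).1, (k2.1 h23).1⟩,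
      if_pos ⟨(k1.1 h12).2, (k2.1 h23).2, hd⟩, one_mul]
  · rw [if_neg H1]
    by_cases H2 : (finProdFinEquiv.symm a.1).1 = (finProdFinEquiv.symm b.1).1 ∧
        (finProdFinEquiv.symm b.1).1 = (finProdFinEquiv.symm c.1).1
    · by_cases H3 : (finProdFinEquiv.symm a.1).2 = (finProdFinEquiv.symm b.1).2 ∧
          (finProdFinEquiv.symm b.1).2 = (finProdFinEquiv.symm c.1).2 ∧
          (a.2.1 : ℕ) = b.2.1 ∧ (b.2.2 : ℕ) = c.2.1 ∧ (a.2.2 : ℕ) = c.2.2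
      · exact absurd ⟨k1.2 ⟨H2.1, H3.1⟩, k2.2 ⟨H2.2, H3.2.1⟩, H3.2.2⟩ H1
      · rw [if_neg H3, mul_zero]
    · rw [if_neg H2, zero_mul]

variable {K}
variable {ι κ μ : Type*} [Fintype ι] [Fintype κ] [Fintype μ] [DecidableEq ι] [DecidableEq κ]
  [DecidableEq μ]

/-- `(⟨e⟩ ⊗ t)^{⊗N} ≥ ⟨e^N⟩ ⊗ t^{⊗N}` (relabelling). [folklore] -/
theorem tensorRestrictsTo_kroneckerPow_unit_kronecker (e : ℕ) (t : ι → κ → μ → K) (N : ℕ) :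
    TensorRestrictsTo (kroneckerPow (kroneckerTensor (unitTensor K e) t) N)
      (kroneckerTensor (unitTensor K (e ^ N)) (kroneckerPow t N)) := by
  classical
  -- `(⟨e⟩ ⊗ t)^{⊗N} ≅ ⟨e⟩^{⊗N} ⊗ t^{⊗N}`
  have h1 : TensorRestrictsTo (kroneckerPow (kroneckerTensor (unitTensor K e) t) N)
      (kroneckerTensor (kroneckerPow (unitTensor K e) N) (kroneckerPow t N)) := by
    rw [kroneckerPow_kroneckerTensor_eq]
    exact tensorRestrictsTo_of_reindex _ _ _ _
  -- `⟨e⟩^{⊗N} ≅ ⟨e^N⟩`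
  have h2 : TensorRestrictsTo (kroneckerPow (unitTensor K e) N) (unitTensor K (e ^ N)) := by
    rw [kroneckerPow_unitTensor_eq]
    exact tensorRestrictsTo_of_reindex _ _ _ _
  exact h1.trans (h2.kronecker (TensorRestrictsTo.refl _))

/-- **`V_ρ(e ⊙ t) ≥ e · V_ρ(t)`** — superadditivity of the value for direct sums of copies
(`e ⊙ t = ⟨e⟩ ⊗ t`; Le Gall: "the value is superadditive"). [cite: LeGall2014, §2.2] -/
theorem HasLaserValue.multiple {ρ : ℝ} {t : ι → κ → μ → K} {v : ℝ} (h : HasLaserValue ρ t v)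
    (e : ℕ) :
    HasLaserValue ρ (kroneckerTensor (unitTensor K e) t) (e * v) := by
  classical
  intro ε hε
  obtain ⟨N, hN, p, k, m, n, hdeg, hb⟩ := h ε hε
  refine ⟨N, hN, e ^ N * p, fun j => k (finProdFinEquiv.symm j).2, fun j => m (finProdFinEquiv.symm j).2,
    fun j => n (finProdFinEquiv.symm j).2, ?_, ?_⟩
  · -- `(⟨e⟩⊗t)^{⊗N} ≥ ⟨e^N⟩ ⊗ t^{⊗N} ⊵ ⟨e^N⟩ ⊗ (⊕ᵢ ⟨kᵢ,mᵢ,nᵢ⟩) ≥ ⊕_{(j,i)} ⟨kᵢ,mᵢ,nᵢ⟩`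
    refine ((tensorRestrictsTo_kroneckerPow_unit_kronecker e t N).polyDegeneratesTo.trans
      ((TensorRestrictsTo.refl (unitTensor K (e ^ N))).polyDegeneratesTo.kronecker hdeg)).trans ?_
    exact (tensorRestrictsTo_unit_kronecker_matMulDirectSum K (e ^ N) k m n).polyDegeneratesTo
  · -- the sum over `e^N · p` blocks is `e^N` times the sum over `p` blocks
    have hsum : ∑ j : Fin (e ^ N * p), ((k (finProdFinEquiv.symm j).2 * m (finProdFinEquiv.symm j).2 *
        n (finProdFinEquiv.symm j).2 : ℕ) : ℝ) ^ (ρ / 3) =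
        (e : ℝ) ^ N * ∑ i, ((k i * m i * n i : ℕ) : ℝ) ^ (ρ / 3) := by
      rw [← Equiv.sum_comp finProdFinEquiv (fun j : Fin (e ^ N * p) =>
        ((k (finProdFinEquiv.symm j).2 * m (finProdFinEquiv.symm j).2 *
          n (finProdFinEquiv.symm j).2 : ℕ) : ℝ) ^ (ρ / 3))]
      simp only [Equiv.symm_apply_apply]
      rw [Fintype.sum_prod_type]
      simp only [Finset.sum_const, Finset.card_univ, Fintype.card_fin, nsmul_eq_mul]
      push_cast
      ring
    rw [hsum, mul_pow, mul_left_comm]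
    exact mul_le_mul_of_nonneg_left hb (by positivity)

end Multiple

/-! ## From the value to the exponent (Le Gall Thm. 2.2, effective form) -/

section Omega

variable {K : Type u} [Field K]
variable {ι κ μ : Type*} [Fintype ι] [Fintype κ] [Fintype μ] [DecidableEq ι] [DecidableEq κ]
  [DecidableEq μ]

/-- **Le Gall 2014, Thm. 2.2 (effective form): `V_ρ(t) > R̃(t) ⇒ ω ≤ ρ`.**  If `V_ρ(t) ≥ v` with
`v > R̃(t)` (`0 < ρ`), then `ω ≤ ρ`: otherwise `ρ < ω` and for every witness
`∑ (kᵢmᵢnᵢ)^{ρ/3} ≤ ∑ (kᵢmᵢnᵢ)^{ω/3} ≤ R̃(⊕ᵢ⟨kᵢ,mᵢ,nᵢ⟩) ≤ R̃(t^{⊗N}) ≤ R̃(t)^N` (asymptotic sum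
inequality `sum_rpow_omega_le_asymptoticRank`, monotonicity of `R̃` under degeneration), whence
`v ≤ (1+ε) R̃(t)` for all `ε > 0`.  (Printed with `V_ρ(t) ≥ R̲(t)`; `R̃ ≤ R̲`, and the strict
inequality is necessary, see the module docstring.) [cite: LeGall2014, Thm. 2.2] -/
theorem omega_le_of_hasLaserValue {ρ : ℝ} (hρ : 0 < ρ) {t : ι → κ → μ → K} {v : ℝ}
    (h : HasLaserValue ρ t v) (hv : asymptoticRank t < v) : omega K ≤ ρ := by
  classical
  by_contra hlt
  rw [not_le] at hlt
  have hR0 : 0 ≤ asymptoticRank t := asymptoticRank_nonneg t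
  have hv0 : 0 < v := lt_of_le_of_lt hR0 hv
  -- `v ≤ (1 + ε) R̃(t)` for every `ε > 0`
  have key : ∀ ε : ℝ, 0 < ε → v ≤ (1 + ε) * asymptoticRank t := by
    intro ε hε
    obtain ⟨N, hN, p, k, m, n, hdeg, hb⟩ := h ε hε
    -- the witness sum at `ρ` is at most the witness sum at `ω`
    have hsum : ∑ i, ((k i * m i * n i : ℕ) : ℝ) ^ (ρ / 3) ≤
        ∑ i, ((k i * m i * n i : ℕ) : ℝ) ^ (omega K / 3) := by
      refine Finset.sum_le_sum fun i _ => ?_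
      rcases Nat.eq_zero_or_pos (k i * m i * n i) with h0 | hpos
      · rw [h0, Nat.cast_zero, Real.zero_rpow (by positivity), Real.zero_rpow]
        have := omega_two_le K; positivity
      · exact Real.rpow_le_rpow_of_exponent_le (by exact_mod_cast hpos) (by linarith)
    -- asymptotic sum inequality and monotonicity of `R̃`
    have hasi := sum_rpow_omega_le_asymptoticRank K k m n
    have hmono : asymptoticRank (matMulDirectSum K k m n) ≤ asymptoticRank t ^ N :=
      (asymptoticRank_le_of_polyDegeneratesTo hdeg).trans (asymptoticRank_kroneckerPow_le t hN)
    have hchain : v ^ N ≤ ((1 + ε) * asymptoticRank t) ^ N := by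
      calc v ^ N ≤ (1 + ε) ^ N * ∑ i, ((k i * m i * n i : ℕ) : ℝ) ^ (ρ / 3) := hb
        _ ≤ (1 + ε) ^ N * asymptoticRank t ^ N :=
            mul_le_mul_of_nonneg_left (hsum.trans (hasi.trans hmono)) (by positivity)
        _ = ((1 + ε) * asymptoticRank t) ^ N := by rw [mul_pow]
    exact le_of_pow_le_pow_left₀ (by omega) (by positivity) hchain
  -- `ε → 0`
  have : v ≤ asymptoticRank t := by
    refine le_of_forall_pos_lt_add fun η hη => ?_
    have h1 := key (η / (2 * (asymptoticRank t + 1))) (by positivity)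
    have h2 : η / (2 * (asymptoticRank t + 1)) * asymptoticRank t < η := by
      rw [div_mul_eq_mul_div, div_lt_iff₀ (by positivity)]
      nlinarith
    nlinarith
  linarith

end Omega

end Literature.Computability.AlgebraicComplexity
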